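import Literature.NumberTheory.LFunctions.MatomakiRadziwillTaoPropA3
import Literature.NumberTheory.LFunctions.MatomakiRadziwillTaoTheoremA2With
import HarnessLib

/-!
# Matomäki–Radziwiłł–Tao 2015, Proposition A.3 with an abstract middle term (schema), and Theorem A.2 from it

Topic `Literature/NumberTheory/LFunctions`.  This file introduces ONE definition, a hypothesis SCHEMA
`MRT2015.PropA3With (mid : ℝ → ℝ) : Prop` (Proposition A.3 for COMPLETELY multiplicative `f` with the middle
term `mid(M)` in place of `(1 + M) e^{-M}`), proves that the named fact `MatomakiRadziwillTao2015_propA3`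
instantiates it, and re-runs the deduction of `MatomakiRadziwillTaoPropA3.lean` (Parseval + the two-sided
A.3) with the abstract middle term: `PropA3With mid → TheoremA2With mid`.  No named fact is introduced.

Purpose.  The dischargers of `MatomakiRadziwillTao2015_propA3` can only reach, with Halász's theorem for
block-restricted sums near the minimising twist, a middle term of type `C (1 + M) e^{-M/2}` (see
`TwistedPrimeSumTail.lean`, "Remark on the regions `𝒯₀ ∪ 𝒯₁`", and `MatomakiRadziwillTaoSiftedDistance.lean`,
"Status").  A theorem `PropA3With (fun M => C * (1 + M) * Real.exp (-M / 2))` — Proposition A.3 for completely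
multiplicative `f` with that middle term, in the exact rendering of the named fact — then gives, through
`theoremA2With_of_propA3With` and `Tao2016_prop24_of_theoremA2With_exp_half` (`TaoLogElliottProp24With.lean`),
Tao 2016, Proposition 2.4 with no further work.

* `MRT2015.PropA3With mid` — the schema (statement of `MatomakiRadziwillTao2015_propA3` verbatim, except
  `f.IsMultiplicative ↦` complete multiplicativity and `errA3 ↦` the explicit sum with `mid M` in the middle);
* `MRT2015.propA3With_of_propA3` — the named fact gives `PropA3With (fun M => (1 + M) e^{-M})`;
* `MRT2015.propA3With_twoSided`, `MRT2015.theoremA2With_core`, `MRT2015.theoremA2With_of_propA3With` — the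
  deduction, proofs of `propA3_twoSided`, `theoremA2_core`, `MatomakiRadziwillTao2015_theoremA2_of_propA3` verbatim.

## References
* K. Matomäki, M. Radziwiłł, T. Tao, *An averaged form of Chowla's conjecture*, Algebra & Number Theory 9 (2015),
  Appendix A: Theorem A.2, the Parseval display, Proposition A.3. [cite: MatomakiRadziwillTao2015, Appendix A, Proposition A.3]

## Design choices
* A parametrised `Prop`, only ever a hypothesis; complete multiplicativity rendered as in `MRT2015.TheoremA2With`.
-/

noncomputable section

open Finset Real MeasureTheory
open scoped Classical ComplexConjugate

namespace Literature.NumberTheory.LFunctions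

open Sieve (SieveIntervalSystem minPretentiousDistSq minPretentiousDistSq_nonneg pretentiousDistSq)

namespace MRT2015

variable {η X₀ : ℝ}

open Literature.Barriers.Parity (conjFun conjFun_apply isMultiplicative_conjFun)

/-- **Proposition A.3 with middle term `mid`, for completely multiplicative `f`** (hypothesis schema): for every
`η ∈ (0, 1/6)` there are `C, Xη` such that for `X > Xη`, `√X ≤ X₀ ≤ X`, `T ≥ 0`, every
`I : SieveIntervalSystem η X₀` and every completely multiplicative `1`-bounded `f`,
`∫_0^T |F(1+it)|² dt ≤ C (T/(X/Q₁) + 1) ((log Q₁)^{1/3}/P₁^{1/6-η} + mid(M(f;X)) + (log X)^{-1/50})`,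
`F = restrDirichlet f I X` — the statement of `MatomakiRadziwillTao2015_propA3` with `(1 + M) e^{-M} ↦ mid M` and
`f.IsMultiplicative ↦` complete multiplicativity (`propA3With_of_propA3`).
[cite: MatomakiRadziwillTao2015, Appendix A, Proposition A.3] -/
def PropA3With (mid : ℝ → ℝ) : Prop :=
  ∀ η : ℝ, 0 < η → η < 1 / 6 → ∃ C Xη : ℝ, ∀ (X X₀ T : ℝ) (I : SieveIntervalSystem η X₀)
    (f : ArithmeticFunction ℂ), (∀ m n : ℕ, f (m * n) = f m * f n) → f 1 = 1 → (∀ n, ‖f n‖ ≤ 1) →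
    Xη < X → Real.sqrt X ≤ X₀ → X₀ ≤ X → 0 ≤ T →
    ∫ t in (0 : ℝ)..T, ‖restrDirichlet f I X t‖ ^ 2 ≤
      C * (T / (X / I.Q 1) + 1) *
        (Real.log (I.Q 1) ^ (1 / 3 : ℝ) / (I.P 1) ^ (1 / 6 - η) + mid (minPretentiousDistSq f X X) +
          1 / Real.log X ^ (1 / 50 : ℝ))

/-- **The named fact instantiates the schema** (`mid M = (1 + M) e^{-M}`; `errA3` unfolded).
[cite: MatomakiRadziwillTao2015, Appendix A, Proposition A.3] -/
theorem propA3With_of_propA3 (hA3 : MatomakiRadziwillTao2015_propA3) :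
    PropA3With (fun M => (1 + M) * Real.exp (-M)) := by
  intro η hη hη'
  obtain ⟨C, Xη, hC⟩ := hA3 η hη hη'
  refine ⟨C, Xη, fun X X₀ T I f hfm hf1 hfb hX hsq hX₀ hT => ?_⟩
  have hf : f.IsMultiplicative := ⟨hf1, fun {m n} _ => hfm m n⟩
  have h := hC X X₀ T I f hf hfb hX hsq hX₀ hT
  unfold errA3 at h
  exact h

/-- The conjugate of a completely multiplicative function is completely multiplicative. [folklore] -/
theorem conjFun_mul {f : ArithmeticFunction ℂ} (hfm : ∀ m n : ℕ, f (m * n) = f m * f n) :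
    ∀ m n : ℕ, conjFun f (m * n) = conjFun f m * conjFun f n := by
  intro m n
  rw [conjFun_apply, conjFun_apply, conjFun_apply, hfm, map_mul]

/-- `conj f (1) = 1` when `f 1 = 1`. [folklore] -/
theorem conjFun_map_one {f : ArithmeticFunction ℂ} (hf1 : f 1 = 1) : conjFun f 1 = 1 := by
  rw [conjFun_apply, hf1, map_one]

/-- **Proposition A.3 with middle term `mid`, two-sided**: under the schema, for `X > X(η)`, `T ≥ 0`,
`∫_0^T (|F(1+it)|² + |F(1-it)|²) dt ≤ 2C (T/(X/Q₁) + 1) E`, by applying the printed one-sided bound to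
`f` and to `conj ∘ f` (same `𝒮`, same `M`, `|F_{conj f}(1+it)| = |F_f(1-it)|`).
[cite: MatomakiRadziwillTao2015, Appendix A, Proposition A.3] -/
theorem propA3With_twoSided {mid : ℝ → ℝ} (hmid0 : ∀ M : ℝ, 0 ≤ M → 0 ≤ mid M) (hA3 : PropA3With mid)
    {η : ℝ} (hη : 0 < η) (hη' : η < 1 / 6) :
    ∃ C Xη : ℝ, 0 ≤ C ∧ ∀ (X X₀ T : ℝ) (I : SieveIntervalSystem η X₀) (f : ArithmeticFunction ℂ),
      (∀ m n : ℕ, f (m * n) = f m * f n) → f 1 = 1 → (∀ n, ‖f n‖ ≤ 1) →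
      Xη < X → Real.sqrt X ≤ X₀ → X₀ ≤ X → 0 ≤ T →
      ∫ t in (0 : ℝ)..T, (‖restrDirichlet f I X t‖ ^ 2 + ‖restrDirichlet f I X (-t)‖ ^ 2) ≤
        2 * C * (T / (X / I.Q 1) + 1) * (Real.log (I.Q 1) ^ (1 / 3 : ℝ) / (I.P 1) ^ (1 / 6 - η) + mid (minPretentiousDistSq f X X) +
          1 / Real.log X ^ (1 / 50 : ℝ)) := by
  obtain ⟨C, Xη, hC⟩ := hA3 η hη hη'
  refine ⟨max C 0, max Xη 1, le_max_right _ _, ?_⟩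
  intro X X₀ T I f hfm hfone hf1 hX hsq hX₀ hT
  have hXη : Xη < X := lt_of_le_of_lt (le_max_left _ _) hX
  have hX1 : 1 ≤ X := (le_max_right _ _).trans hX.le
  have hX0 : 0 < X := by linarith
  have hQ1 : 1 ≤ I.Q 1 := I.one_le_Q hη (by linarith) le_rfl
  have hQ0 : 0 < I.Q 1 := by linarith
  have hP0 : 0 < I.P 1 := I.pos_P 1 le_rfl
  set E := (Real.log (I.Q 1) ^ (1 / 3 : ℝ) / (I.P 1) ^ (1 / 6 - η) + mid (minPretentiousDistSq f X X) +
          1 / Real.log X ^ (1 / 50 : ℝ)) with hE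
  have hE0 : 0 ≤ E := by
    have hm := hmid0 _ (minPretentiousDistSq_nonneg hf1 X hX0.le)
    have h1 : 0 ≤ Real.log (I.Q 1) := Real.log_nonneg hQ1
    have h2 : 0 ≤ Real.log X := Real.log_nonneg hX1
    rw [hE]; positivity
  have hfac : 0 ≤ T / (X / I.Q 1) + 1 := by positivity
  -- the printed bound for `f` and for `conj f`
  have h1 := hC X X₀ T I f hfm hfone hf1 hXη hsq hX₀ hT
  have h2 := hC X X₀ T I (conjFun f) (conjFun_mul hfm) (conjFun_map_one hfone) (norm_conjFun_le hf1) hXη hsq hX₀ hT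
  rw [minPretentiousDistSq_conjFun] at h2
  simp_rw [norm_restrDirichlet_conjFun] at h2
  have hCle : C * (T / (X / I.Q 1) + 1) * E ≤ max C 0 * (T / (X / I.Q 1) + 1) * E :=
    mul_le_mul_of_nonneg_right (mul_le_mul_of_nonneg_right (le_max_left _ _) hfac) hE0
  have i1 : IntervalIntegrable (fun t => ‖restrDirichlet f I X t‖ ^ 2) volume 0 T :=
    ((continuous_restrDirichlet f I X).norm.pow 2).intervalIntegrable _ _
  have i2 : IntervalIntegrable (fun t => ‖restrDirichlet f I X (-t)‖ ^ 2) volume 0 T :=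
    (((continuous_restrDirichlet f I X).comp continuous_neg).norm.pow 2).intervalIntegrable _ _
  rw [intervalIntegral.integral_add i1 i2]
  change (∫ t in (0 : ℝ)..T, ‖restrDirichlet f I X t‖ ^ 2)
      + (∫ t in (0 : ℝ)..T, ‖restrDirichlet f I X (-t)‖ ^ 2) ≤ 2 * max C 0 * (T / (X / I.Q 1) + 1) * E
  linarith


/-! ### Theorem A.2 from the schema -/

open Parseval in
/-- **Theorem A.2 for `1 ≤ h ≤ X` from Proposition A.3, middle term `mid`** (the heart of the deduction): the Parseval
bound `meanSquare_shortAvg_le` applied to `a_n = f(n) 1_𝒮(n)`, with the two mean values controlled by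
the two-sided Proposition A.3: `∫_0^{X/h} B ≤ 2C₃ (Q₁/h + 1) E ≤ 4 C₃ E` and
`(X/h)/T ∫_T^{2T} B ≤ 2C₃ (2Q₁/h + (X/h)/T) E ≤ 6 C₃ E` for `T ≥ X/h` (using `Q₁ ≤ h`).
[cite: MatomakiRadziwillTao2015, Appendix A, Theorem A.2] -/
theorem theoremA2With_core {mid : ℝ → ℝ} (hmid0 : ∀ M : ℝ, 0 ≤ M → 0 ≤ mid M) (hA3 : PropA3With mid)
    {η : ℝ} (hη : 0 < η) (hη' : η < 1 / 6) :
    ∃ C Xη : ℝ, 0 ≤ C ∧ ∀ (X X₀ h : ℝ) (I : SieveIntervalSystem η X₀) (f : ArithmeticFunction ℂ),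
      (∀ m n : ℕ, f (m * n) = f m * f n) → f 1 = 1 → (∀ n, ‖f n‖ ≤ 1) →
      Xη < X → 1 ≤ h → h ≤ X → Real.sqrt X ≤ X₀ → X₀ ≤ X → I.Q 1 ≤ h →
      1 / X * ∫ x in X..(2 * X), ‖(h : ℂ)⁻¹ * shortSumA2 f I X h x‖ ^ 2 ≤
        C * (Real.log (I.Q 1) ^ (1 / 3 : ℝ) / (I.P 1) ^ (1 / 6 - η) + mid (minPretentiousDistSq f X X) +
          1 / Real.log X ^ (1 / 50 : ℝ)) := by
  obtain ⟨C₃, X₃, hC₃, h3⟩ := propA3With_twoSided hmid0 hA3 hη hη'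
  obtain ⟨Cp, hCp, hP⟩ := meanSquare_shortAvg_le
  refine ⟨10 * Cp * C₃, max X₃ 1, by positivity, ?_⟩
  intro X X₀ h I f hfm hfone hf1 hX hh hhX hsq hX₀ hQh
  have hX₃ : X₃ < X := lt_of_le_of_lt (le_max_left _ _) hX
  have hX1 : 1 ≤ X := (le_max_right _ _).trans hX.le
  have hX0 : 0 < X := by linarith
  have hh0 : 0 < h := by linarith
  have hQ1 : 1 ≤ I.Q 1 := I.one_le_Q hη (by linarith) le_rfl
  have hQ0 : 0 < I.Q 1 := by linarith
  have hP0 : 0 < I.P 1 := I.pos_P 1 le_rfl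
  set E := (Real.log (I.Q 1) ^ (1 / 3 : ℝ) / (I.P 1) ^ (1 / 6 - η) + mid (minPretentiousDistSq f X X) +
          1 / Real.log X ^ (1 / 50 : ℝ)) with hE
  have hE0 : 0 ≤ E := by
    have hm := hmid0 _ (minPretentiousDistSq_nonneg hf1 X hX0.le)
    have h1 : 0 ≤ Real.log (I.Q 1) := Real.log_nonneg hQ1
    have h2 : 0 ≤ Real.log X := Real.log_nonneg hX1
    rw [hE]; positivity
  set a : ℕ → ℂ := fun m => if I.Mem m then f m else 0 with ha_def
  have ha : ∀ m, ‖a m‖ ≤ 1 := fun m => by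
    simp only [ha_def]; split_ifs
    · exact hf1 m
    · simp
  set U := X / h with hU
  have hU0 : 0 < U := by positivity
  have hUQ : U / (X / I.Q 1) = I.Q 1 / h := by rw [hU]; field_simp
  have hQh1 : I.Q 1 / h ≤ 1 := by rw [div_le_one hh0]; exact hQh
  -- the Parseval bound
  have hPar := hP X h a hX1 hh hhX ha
  have hlhs : (fun x => ‖(h : ℂ)⁻¹ * ∑ m ∈ (Icc ⌈x⌉₊ ⌊x + h⌋₊).filter
      (fun m : ℕ => X ≤ m ∧ (m : ℝ) ≤ 2 * X), a m‖ ^ 2)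
      = fun x => ‖(h : ℂ)⁻¹ * shortSumA2 f I X h x‖ ^ 2 := by
    funext x; rw [shortSumA2_eq_sum_filter]
  rw [hlhs] at hPar
  have hB : ∀ t, Bsq X a t = ‖restrDirichlet f I X t‖ ^ 2 + ‖restrDirichlet f I X (-t)‖ ^ 2 := by
    intro t; simp only [Bsq, ha_def, Apoly_eq_restrDirichlet]
  -- the mean value over `[0, U]`
  have hI : ∫ t in (0 : ℝ)..U, Bsq X a t ≤ 4 * C₃ * E := by
    simp_rw [hB]
    have hh3 := h3 X X₀ U I f hfm hfone hf1 hX₃ hsq hX₀ hU0.le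
    rw [hUQ] at hh3
    refine hh3.trans ?_
    have : 2 * C₃ * (I.Q 1 / h + 1) * E ≤ 2 * C₃ * 2 * E := by
      refine mul_le_mul_of_nonneg_right ?_ hE0
      exact mul_le_mul_of_nonneg_left (by linarith) (by positivity)
    linarith
  -- the `sup` term
  have hS : Ssup X a U ≤ 6 * C₃ * E := by
    haveI : Nonempty (Set.Ici U) := ⟨⟨U, Set.self_mem_Ici⟩⟩
    refine ciSup_le fun T' => ?_
    obtain ⟨T, hTmem⟩ := T'
    have hT : U ≤ T := hTmem
    have hT0 : 0 < T := hU0.trans_le hT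
    change U / T * ∫ t in T..2 * T, Bsq X a t ≤ 6 * C₃ * E
    have hcont : Continuous (Bsq X a) := continuous_Bsq X hX1 a
    have step1 : ∫ t in T..2 * T, Bsq X a t ≤ ∫ t in (0 : ℝ)..2 * T, Bsq X a t :=
      intervalIntegral.integral_mono_interval hT0.le (by linarith) le_rfl
        (ae_of_all _ fun t => Bsq_nonneg X a t) (hcont.intervalIntegrable _ _)
    have step2 : ∫ t in (0 : ℝ)..2 * T, Bsq X a t ≤ 2 * C₃ * (2 * T / (X / I.Q 1) + 1) * E := by
      simp_rw [hB]
      exact h3 X X₀ (2 * T) I f hfm hfone hf1 hX₃ hsq hX₀ (by linarith)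
    have hfac : U / T * (2 * T / (X / I.Q 1) + 1) ≤ 3 := by
      have e1 : U / T * (2 * T / (X / I.Q 1)) = 2 * (I.Q 1 / h) := by
        rw [hU]; field_simp
      have e2 : U / T ≤ 1 := by rw [div_le_one hT0]; exact hT
      rw [mul_add, e1, mul_one]
      linarith
    calc U / T * ∫ t in T..2 * T, Bsq X a t
        ≤ U / T * (2 * C₃ * (2 * T / (X / I.Q 1) + 1) * E) :=
          mul_le_mul_of_nonneg_left (step1.trans step2) (by positivity)
      _ = (U / T * (2 * T / (X / I.Q 1) + 1)) * (2 * C₃ * E) := by ring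
      _ ≤ 3 * (2 * C₃ * E) := mul_le_mul_of_nonneg_right hfac (by positivity)
      _ = 6 * C₃ * E := by ring
  calc 1 / X * ∫ x in X..(2 * X), ‖(h : ℂ)⁻¹ * shortSumA2 f I X h x‖ ^ 2
      ≤ Cp * ((∫ t in (0 : ℝ)..X / h, Bsq X a t) + Ssup X a (X / h)) := hPar
    _ ≤ Cp * (4 * C₃ * E + 6 * C₃ * E) := mul_le_mul_of_nonneg_left (add_le_add hI hS) hCp.le
    _ = 10 * Cp * C₃ * E := by ring

/-- **Theorem A.2 from Proposition A.3, with an abstract middle term** (`PropA3With mid → TheoremA2With mid`,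
`mid ≥ 0`; Algebra & Number Theory 9
(2015), Appendix A: "Theorem A.2 now follows immediately from the following variant of [MR]",
i.e. from the Parseval bound and Proposition A.3).  Proof: for `h ≤ X`, `theoremA2_core` (the
Parseval bound of `MatomakiRadziwillTaoParseval.lean` for `a_n = f(n)1_𝒮(n)` and the two-sided
Proposition A.3), followed by `(log Q₁)^{1/3} ≤ (log h)^{1/3}` (`Q₁ ≤ h`); for `h > X` the restricted
window sum equals the one for `h = X` (`shortSumA2_of_le`), `h⁻² ≤ X⁻²`, `Q₁ ≤ exp(√(log X₀)) ≤ X`, and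
`(log X)^{1/3} ≤ (log h)^{1/3}`.  The constant is `10 C_P C₃` and `X(η) = max(X₃(η), 3)`; proof of
`MatomakiRadziwillTao2015_theoremA2_of_propA3` verbatim. [cite: MatomakiRadziwillTao2015, Appendix A, Theorem A.2] -/
theorem theoremA2With_of_propA3With {mid : ℝ → ℝ} (hmid0 : ∀ M : ℝ, 0 ≤ M → 0 ≤ mid M)
    (hA3 : PropA3With mid) : TheoremA2With mid := by
  intro η hη hη'
  obtain ⟨C, Xc, hC0, hcore⟩ := theoremA2With_core hmid0 hA3 hη hη'
  refine ⟨C, max Xc 3, ?_⟩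
  intro X X₀ h I f hfm hfone hf1 hX hh3 hsq hX₀ hQh
  have hXc : Xc < X := lt_of_le_of_lt (le_max_left _ _) hX
  have hX3 : 3 < X := lt_of_le_of_lt (le_max_right _ _) hX
  have hX1 : 1 ≤ X := by linarith
  have hX0 : 0 < X := by linarith
  have hQ1 : 1 ≤ I.Q 1 := I.one_le_Q hη (by linarith) le_rfl
  have hQ0 : 0 < I.Q 1 := by linarith
  have hP0 : 0 < I.P 1 := I.pos_P 1 le_rfl
  set M := minPretentiousDistSq f X X with hM
  have hM0 : 0 ≤ M := minPretentiousDistSq_nonneg hf1 X hX0.le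
  -- monotonicity of the first error term in its logarithm
  have hmono : ∀ {L : ℝ}, I.Q 1 ≤ L →
      (Real.log (I.Q 1) ^ (1 / 3 : ℝ) / (I.P 1) ^ (1 / 6 - η) + mid M + 1 / Real.log X ^ (1 / 50 : ℝ)) ≤
        mid M + Real.log L ^ (1 / 3 : ℝ) / I.P 1 ^ (1 / 6 - η) + 1 / Real.log X ^ (1 / 50 : ℝ) := by
    intro L hL
    have h1 : Real.log (I.Q 1) ^ (1 / 3 : ℝ) ≤ Real.log L ^ (1 / 3 : ℝ) :=
      Real.rpow_le_rpow (Real.log_nonneg hQ1) (Real.log_le_log hQ0 hL) (by norm_num)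
    have h2 : Real.log (I.Q 1) ^ (1 / 3 : ℝ) / I.P 1 ^ (1 / 6 - η) ≤ Real.log L ^ (1 / 3 : ℝ) / I.P 1 ^ (1 / 6 - η) :=
      div_le_div_of_nonneg_right h1 (Real.rpow_pos_of_pos hP0 _).le
    linarith
  rcases le_or_gt h X with hhX | hhX
  · -- `h ≤ X`
    have h1 := hcore X X₀ h I f hfm hfone hf1 hXc (by linarith) hhX hsq hX₀ hQh
    exact h1.trans (mul_le_mul_of_nonneg_left (hmono hQh) hC0)
  · -- `h > X`: reduce to `h = X`
    have hX₀0 : 0 < X₀ := (Real.sqrt_pos.2 hX0).trans_le hsq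
    have hQX : I.Q 1 ≤ X := by
      calc I.Q 1 ≤ Real.exp (Real.sqrt (Real.log X₀)) := I.Q_one_le hη (by linarith)
        _ ≤ Real.exp (Real.sqrt (Real.log X)) := by
            refine Real.exp_le_exp.2 (Real.sqrt_le_sqrt (Real.log_le_log hX₀0 hX₀))
        _ ≤ X := exp_sqrt_log_le (le_trans (by have := Real.exp_one_lt_d9; norm_num at this; linarith) hX3.le)
    have h1 := hcore X X₀ X I f hfm hfone hf1 hXc hX1 le_rfl hsq hX₀ hQX
    -- compare the integrands pointwise on `(X, 2X]`
    have hptw : ∀ x ∈ Set.Ioc X (2 * X),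
        ‖(h : ℂ)⁻¹ * shortSumA2 f I X h x‖ ^ 2 ≤ ‖(X : ℂ)⁻¹ * shortSumA2 f I X X x‖ ^ 2 := by
      intro x hx
      rw [shortSumA2_of_le I hx.1.le hhX.le, norm_mul, norm_mul, norm_inv, norm_inv,
        Complex.norm_real, Complex.norm_real, Real.norm_eq_abs, Real.norm_eq_abs,
        abs_of_pos (hX0.trans hhX), abs_of_pos hX0]
      have : h⁻¹ ≤ X⁻¹ := (inv_le_inv₀ (hX0.trans hhX) hX0).2 hhX.le
      gcongr
    have hint : ∀ {k : ℝ}, 0 < k → IntervalIntegrable (fun x => ‖(k : ℂ)⁻¹ * shortSumA2 f I X k x‖ ^ 2)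
        volume X (2 * X) := by
      intro k hk
      have e : (fun x => ‖(k : ℂ)⁻¹ * shortSumA2 f I X k x‖ ^ 2) = fun x => k⁻¹ ^ 2 * sqIntegrand f I X k x := by
        funext x
        rw [sqIntegrand, norm_mul, mul_pow, norm_inv, Complex.norm_real, Real.norm_eq_abs, abs_of_pos hk]
      rw [e]
      exact (intervalIntegrable_sqIntegrand hf1 I X hk.le X (2 * X)).const_mul _
    have hle : ∫ x in X..(2 * X), ‖(h : ℂ)⁻¹ * shortSumA2 f I X h x‖ ^ 2
        ≤ ∫ x in X..(2 * X), ‖(X : ℂ)⁻¹ * shortSumA2 f I X X x‖ ^ 2 := by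
      rw [intervalIntegral.integral_of_le (by linarith), intervalIntegral.integral_of_le (by linarith)]
      refine setIntegral_mono_on ?_ ?_ measurableSet_Ioc hptw
      · exact ((hint (hX0.trans hhX)).1)
      · exact ((hint hX0).1)
    calc 1 / X * ∫ x in X..(2 * X), ‖(h : ℂ)⁻¹ * shortSumA2 f I X h x‖ ^ 2
        ≤ 1 / X * ∫ x in X..(2 * X), ‖(X : ℂ)⁻¹ * shortSumA2 f I X X x‖ ^ 2 :=
          mul_le_mul_of_nonneg_left hle (by positivity)
      _ ≤ C * (Real.log (I.Q 1) ^ (1 / 3 : ℝ) / (I.P 1) ^ (1 / 6 - η) + mid M + 1 / Real.log X ^ (1 / 50 : ℝ)) := h1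
      _ ≤ C * (mid M + Real.log h ^ (1 / 3 : ℝ) / I.P 1 ^ (1 / 6 - η)
            + 1 / Real.log X ^ (1 / 50 : ℝ)) :=
          mul_le_mul_of_nonneg_left (hmono (hQX.trans hhX.le)) hC0

end MRT2015

end Literature.NumberTheory.LFunctions

end
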